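import Mathlib.Analysis.Calculus.LocalExtr.Basic
import Mathlib.Analysis.Calculus.Deriv.Pow
import Mathlib.Analysis.SpecialFunctions.ExpDeriv
import Mathlib.Analysis.SpecialFunctions.Log.Deriv
import Mathlib.Analysis.Convex.SpecificFunctions.Basic
import Literature.Computability.AlgebraicComplexity.QuantumFunctionals
import Literature.Computability.AlgebraicComplexity.QuantumFunctionalsProofs
import Literature.Computability.AlgebraicComplexity.QuantumFunctionalsDegenerationProofs
import HarnessLib

/-!
# Quantum functionals of free tensors: `ρ^θ(t) ≤ E_θ(t)` (CVZ Thm. 4.20), proofs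

Topic: `Literature/Computability/AlgebraicComplexity`; proofs for the named fact
`ChristandlVranaZuiddam2023_free` of `QuantumFunctionals.lean` (M. Christandl, P. Vrana, J. Zuiddam,
*Universal points in the asymptotic spectrum of tensors*, J. Amer. Math. Soc. 36 (2023) =
arXiv:1709.07851v3, Thm. 4.20: for a free tensor `t` and `θ ∈ P([3])`,
`ρ^θ(t) = E^θ(t) = E_θ(t)`).

The printed proof of Thm. 4.20 has two halves.

* `ρ^θ(t) ≥ E^θ(t) = E_θ(t)` for *every* `t`: Thm. 3.34 (isotypic projectors of the Schur–Weyl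
  decomposition, the majorisation property Rem. 3.33, decomposition of `t^{⊗N}` into type classes) and
  Thm. 3.30 (upper = lower quantum functional, via the entanglement-polytope characterisation Thm. 3.10).
  This is the named fact `ChristandlVranaZuiddam2023_le_upperSupportFunctional` of the tree and is NOT
  proved here (it needs Schur–Weyl / moment-polytope theory absent from Mathlib).
* `ρ^θ(t) ≤ E_θ(t)` for free `t` (p. 24 of the source): if `Φ = supp_C t` is free then every
  `P ∈ P(Φ)` has its triple of marginals in the torus moment polytope `μ_T(cl(T·t))`, and freeness makes
  the reduced density matrices of every `s ∈ T·t` diagonal, so `H_θ(P) ≤ sup_{s ∈ T·t} H_θ(s) ≤ E_θ(t)`.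
  **This half is proved here in full** (`logUpperSupportFunctional_le_logQuantumFunctional_of_isFree`),
  with the "nontrivial fact that `μ_T(cl(T·t))` is a convex polytope" (Atiyah) replaced by an elementary
  log-partition-function argument (`exists_gibbs_moments_approx`): for target moments `m = 𝔼_P[w]` of
  features `w` and `δ > 0`, a minimiser `h` of the coercive function
  `G(h) = log ∑ₓ qₓ e^{⟨h, wₓ⟩} - ⟨h, m⟩ + ε ‖h‖₂²` has vanishing partial derivatives, which says that
  the Gibbs distribution `qₓ e^{⟨h,wₓ⟩} / Z(h)` has moments within `2ε|hⱼ| ≤ δ` of `m`; the torus element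
  `diag(e^{h/2})` realises this Gibbs distribution as `|s|² / ‖s‖²`.

Consequently (`ChristandlVranaZuiddam2023_free_of_le_upperSupportFunctional`) the fact
`ChristandlVranaZuiddam2023_free` follows from `ChristandlVranaZuiddam2023_le_upperSupportFunctional`
alone. No new definitions are introduced; the composition law `actTensor_actTensor`
(`QuantumFunctionalsDegenerationProofs.lean`) and the entry formulas `reducedDensity₂/₃_apply`
(`QuantumFunctionalsProofs.lean`) are reused from the sibling proof files.
-/

noncomputable section

open scoped BigOperators Matrix ComplexOrder
open Real (negMulLog)

namespace Literature.Computability.AlgebraicComplexity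

/-! ## Gibbs distributions with prescribed moments (elementary torus moment-map convexity) -/

section Gibbs

variable {X J : Type*} [Fintype X] [Fintype J]

/-- Moving along the `j`-th coordinate direction changes `⟨h, v⟩` by `s vⱼ`. [folklore] -/
theorem sum_add_smul_single_mul [DecidableEq J] (h₀ : J → ℝ) (j : J) (s : ℝ) (v : J → ℝ) :
    ∑ i, (h₀ + s • Pi.single j (1 : ℝ) : J → ℝ) i * v i = ∑ i, h₀ i * v i + s * v j := by
  simp only [Pi.add_apply, Pi.smul_apply, Pi.single_apply, smul_eq_mul, mul_ite, mul_one, mul_zero,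
    add_mul, Finset.sum_add_distrib, ite_mul, zero_mul, Finset.sum_ite_eq', Finset.mem_univ, if_true]

/-- Moving along the `j`-th coordinate direction changes `‖h‖₂²` by `2 hⱼ s + s²`. [folklore] -/
theorem sum_add_smul_single_sq [DecidableEq J] (h₀ : J → ℝ) (j : J) (s : ℝ) :
    ∑ i, (h₀ + s • Pi.single j (1 : ℝ) : J → ℝ) i ^ 2 = ∑ i, h₀ i ^ 2 + (2 * h₀ j * s + s ^ 2) := by
  have : ∀ i, (h₀ + s • Pi.single j (1 : ℝ) : J → ℝ) i ^ 2 =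
      h₀ i ^ 2 + (if i = j then 2 * h₀ j * s + s ^ 2 else 0) := by
    intro i
    simp only [Pi.add_apply, Pi.smul_apply, Pi.single_apply, smul_eq_mul, mul_ite, mul_one, mul_zero]
    split_ifs with hij
    · subst hij; ring
    · ring
  simp only [this, Finset.sum_add_distrib, Finset.sum_ite_eq', Finset.mem_univ, if_true]

/-- **Gibbs distributions realise every point of the marginal polytope approximately.**
For weights `q ≥ 0` on a finite set `X`, features `w : X → ℝ^J`, a probability vector `P` supported
inside `supp q`, and `δ > 0`, there is `h ∈ ℝ^J` such that the Gibbs distribution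
`Qₕ(x) = q(x) e^{⟨h, w(x)⟩} / ∑_y q(y) e^{⟨h, w(y)⟩}` has every moment `𝔼_{Qₕ}[wⱼ]` within `δ` of
`𝔼_P[wⱼ]`. (Closure of the image of the gradient of the log-partition function contains the convex
hull of the features; the elementary core of the torus moment-polytope convexity used in the
proof of CVZ Thm. 4.20.) Proof: minimise the coercive
`G(h) = log Z(h) - ⟨h, 𝔼_P w⟩ + ε‖h‖₂²` and read off `∂ⱼ G = 0`. [folklore] -/
theorem exists_gibbs_moments_approx (q P : X → ℝ) (hq : ∀ x, 0 ≤ q x) (hP0 : ∀ x, 0 ≤ P x)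
    (hP1 : ∑ x, P x = 1) (hPq : ∀ x, P x ≠ 0 → q x ≠ 0) (w : X → J → ℝ) {δ : ℝ} (hδ : 0 < δ) :
    ∃ h : J → ℝ, ∀ j,
      |(∑ x, q x * Real.exp (∑ i, h i * w x i) * w x j) / (∑ x, q x * Real.exp (∑ i, h i * w x i)) -
        ∑ x, P x * w x j| ≤ δ := by
  classical
  -- a point of positive `P`-mass
  obtain ⟨x₀, -, hx₀⟩ : ∃ x ∈ Finset.univ, P x ≠ 0 :=
    Finset.exists_ne_zero_of_sum_ne_zero (by rw [hP1]; exact one_ne_zero)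
  -- `c > 0` with `c P ≤ q`
  obtain ⟨c, hc, hcPq⟩ : ∃ c : ℝ, 0 < c ∧ ∀ x, c * P x ≤ q x := by
    let f : X → ℝ := fun x => if P x = 0 then 1 else q x / P x
    have hfpos : ∀ x, 0 < f x := by
      intro x
      simp only [f]
      split_ifs with hx
      · exact one_pos
      · exact div_pos ((hq x).lt_of_ne' (hPq x hx)) ((hP0 x).lt_of_ne' hx)
    obtain ⟨x₁, -, hx₁⟩ := Finset.exists_min_image Finset.univ f ⟨x₀, Finset.mem_univ _⟩
    refine ⟨f x₁, hfpos x₁, fun x => ?_⟩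
    by_cases hx : P x = 0
    · rw [hx, mul_zero]; exact hq x
    · have h1 : f x₁ ≤ q x / P x := by
        have := hx₁ x (Finset.mem_univ x)
        simp only [f, if_neg hx] at this ⊢
        exact this
      rwa [le_div_iff₀ ((hP0 x).lt_of_ne' hx)] at h1
  -- the partition function `Z`, the linear term `L`, and the lower bound `Z ≥ c e^L`
  obtain ⟨Z, hZ⟩ : ∃ Z : (J → ℝ) → ℝ, ∀ h, Z h = ∑ x, q x * Real.exp (∑ i, h i * w x i) :=
    ⟨_, fun _ => rfl⟩
  obtain ⟨L, hL⟩ : ∃ L : (J → ℝ) → ℝ, ∀ h, L h = ∑ x, P x * ∑ i, h i * w x i := ⟨_, fun _ => rfl⟩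
  have hZL : ∀ h, c * Real.exp (L h) ≤ Z h := by
    intro h
    rw [hZ, hL]
    have hJ := (convexOn_exp).map_sum_le (t := Finset.univ) (w := P)
      (p := fun x => ∑ i, h i * w x i) (fun x _ => hP0 x) hP1 (fun x _ => Set.mem_univ _)
    simp only [smul_eq_mul] at hJ
    calc c * Real.exp (∑ x, P x * ∑ i, h i * w x i)
        ≤ c * ∑ x, P x * Real.exp (∑ i, h i * w x i) := mul_le_mul_of_nonneg_left hJ hc.le
      _ = ∑ x, c * P x * Real.exp (∑ i, h i * w x i) := by
          rw [Finset.mul_sum]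
          exact Finset.sum_congr rfl fun x _ => by ring
      _ ≤ ∑ x, q x * Real.exp (∑ i, h i * w x i) :=
          Finset.sum_le_sum fun x _ => mul_le_mul_of_nonneg_right (hcPq x) (Real.exp_pos _).le
  have hZpos : ∀ h, 0 < Z h := fun h => (mul_pos hc (Real.exp_pos _)).trans_le (hZL h)
  have hlogZ : ∀ h, Real.log c + L h ≤ Real.log (Z h) := by
    intro h
    have := Real.log_le_log (mul_pos hc (Real.exp_pos _)) (hZL h)
    rwa [Real.log_mul hc.ne' (Real.exp_pos _).ne', Real.log_exp] at this
  have hL0 : L 0 = 0 := by simp [hL]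
  -- constants
  set K : ℝ := Real.log (Z 0) with hK
  have hKc : Real.log c ≤ K := by simpa [hL0] using hlogZ 0
  set M : ℝ := K - Real.log c + 1 with hM
  have hMpos : 0 < M := by rw [hM]; linarith
  set R : ℝ := 2 * M / δ with hR
  have hRpos : 0 < R := by rw [hR]; positivity
  set ε : ℝ := δ / (2 * R) with hε
  have hεpos : 0 < ε := by rw [hε]; positivity
  have hεR : ε * R ^ 2 = M := by
    rw [hε, hR]; field_simp
  have h2εR : 2 * ε * R = δ := by
    rw [hε]; field_simp
  -- the penalised objective
  obtain ⟨G, hG⟩ : ∃ G : (J → ℝ) → ℝ, ∀ h, G h = Real.log (Z h) - L h + ε * ∑ j, h j ^ 2 :=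
    ⟨_, fun _ => rfl⟩
  have hGlb : ∀ h, Real.log c + ε * ∑ j, h j ^ 2 ≤ G h := by
    intro h; rw [hG]; linarith [hlogZ h]
  have hG0 : G 0 = K := by simp [hG, hL0, hK]
  have hZc : Continuous Z := by
    rw [show Z = fun h => ∑ x, q x * Real.exp (∑ i, h i * w x i) from funext hZ]
    fun_prop
  have hLc : Continuous L := by
    rw [show L = fun h => ∑ x, P x * ∑ i, h i * w x i from funext hL]
    fun_prop
  have hGc : Continuous G := by
    rw [show G = fun h => Real.log (Z h) - L h + ε * ∑ j, h j ^ 2 from funext hG]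
    exact ((hZc.log fun h => (hZpos h).ne').sub hLc).add (by fun_prop)
  -- a minimiser on the closed ball of radius `R`, which is a global minimiser
  obtain ⟨h₀, hh₀, hmin⟩ := (isCompact_closedBall (0 : J → ℝ) R).exists_isMinOn
    ⟨0, Metric.mem_closedBall_self hRpos.le⟩ hGc.continuousOn
  have hglob : ∀ h, G h₀ ≤ G h := by
    intro h
    by_cases hh : h ∈ Metric.closedBall (0 : J → ℝ) R
    · exact hmin hh
    · rw [mem_closedBall_zero_iff, pi_norm_le_iff_of_nonneg hRpos.le, not_forall] at hh
      obtain ⟨j, hj⟩ := hh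
      rw [not_le, Real.norm_eq_abs] at hj
      have h1 : R ^ 2 < ∑ i, h i ^ 2 := by
        calc R ^ 2 < |h j| ^ 2 := by gcongr
          _ = h j ^ 2 := sq_abs _
          _ ≤ ∑ i, h i ^ 2 := Finset.single_le_sum (fun i _ => sq_nonneg (h i)) (Finset.mem_univ j)
      have h2 : G 0 < G h := by
        calc G 0 = K := hG0
          _ < Real.log c + ε * R ^ 2 := by rw [hεR, hM]; linarith
          _ ≤ Real.log c + ε * ∑ i, h i ^ 2 := by gcongr
          _ ≤ G h := hGlb h
      exact (hmin (Metric.mem_closedBall_self hRpos.le)).trans h2.le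
  have hh₀j : ∀ j, |h₀ j| ≤ R := fun j => by
    have := norm_le_pi_norm h₀ j
    rw [Real.norm_eq_abs] at this
    exact this.trans (mem_closedBall_zero_iff.1 hh₀)
  -- first-order condition in each coordinate direction
  refine ⟨h₀, fun j => ?_⟩
  have hline : ∀ s : ℝ, G (h₀ + s • Pi.single j (1 : ℝ)) =
      Real.log (∑ x, q x * Real.exp ((∑ i, h₀ i * w x i) + s * w x j)) -
        (L h₀ + s * ∑ x, P x * w x j) +
        ε * (∑ i, h₀ i ^ 2 + (2 * h₀ j * s + s ^ 2)) := by
    intro s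
    rw [hG, hZ, hL, hL, sum_add_smul_single_sq]
    congr 2
    · congr 1
      exact Finset.sum_congr rfl fun x _ => by rw [sum_add_smul_single_mul]
    · rw [Finset.mul_sum, ← Finset.sum_add_distrib]
      exact Finset.sum_congr rfl fun x _ => by rw [sum_add_smul_single_mul]; ring
  have hlocmin : IsLocalMin (fun s : ℝ =>
      Real.log (∑ x, q x * Real.exp ((∑ i, h₀ i * w x i) + s * w x j)) -
        (L h₀ + s * ∑ x, P x * w x j) +
        ε * (∑ i, h₀ i ^ 2 + (2 * h₀ j * s + s ^ 2))) 0 := by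
    refine Filter.Eventually.of_forall fun s => ?_
    dsimp only
    rw [← hline s, ← hline 0]
    simpa using hglob (h₀ + s • Pi.single j (1 : ℝ))
  have hFpos : 0 < ∑ x, q x * Real.exp ((∑ i, h₀ i * w x i) + 0 * w x j) := by
    have := hZpos h₀
    rw [hZ] at this
    simpa using this
  have hderiv : HasDerivAt (fun s : ℝ =>
      Real.log (∑ x, q x * Real.exp ((∑ i, h₀ i * w x i) + s * w x j)) -
        (L h₀ + s * ∑ x, P x * w x j) +
        ε * (∑ i, h₀ i ^ 2 + (2 * h₀ j * s + s ^ 2)))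
      ((∑ x, q x * (Real.exp ((∑ i, h₀ i * w x i) + 0 * w x j) * (1 * w x j))) /
          (∑ x, q x * Real.exp ((∑ i, h₀ i * w x i) + 0 * w x j)) -
        (1 * ∑ x, P x * w x j) +
        ε * (2 * h₀ j * 1 + (2 : ℕ) * (0 : ℝ) ^ (2 - 1))) 0 := by
    refine ((HasDerivAt.log ?_ hFpos.ne').sub ?_).add ?_
    · exact HasDerivAt.fun_sum fun x _ =>
        (((hasDerivAt_id' (0 : ℝ)).mul_const (w x j)).const_add _).exp.const_mul (q x)
    · exact ((hasDerivAt_id' (0 : ℝ)).mul_const _).const_add _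
    · exact (((hasDerivAt_id' (0 : ℝ)).const_mul (2 * h₀ j)).add (hasDerivAt_pow 2 (0 : ℝ))).const_add
        _ |>.const_mul ε
  have hD := hlocmin.hasDerivAt_eq_zero hderiv
  simp only [zero_mul, add_zero, one_mul, mul_one, Nat.cast_ofNat] at hD
  -- `hD : (∑ x, q x * (exp A x * w x j)) / (∑ x, q x * exp A x) - ∑ x, P x * w x j + ε * (2 * h₀ j) = 0`
  have hkey : (∑ x, q x * Real.exp (∑ i, h₀ i * w x i) * w x j) /
        (∑ x, q x * Real.exp (∑ i, h₀ i * w x i)) - ∑ x, P x * w x j = -(ε * (2 * h₀ j)) := by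
    have : (∑ x, q x * Real.exp (∑ i, h₀ i * w x i) * w x j) =
        ∑ x, q x * (Real.exp (∑ i, h₀ i * w x i) * w x j) :=
      Finset.sum_congr rfl fun x _ => mul_assoc _ _ _
    rw [this]
    linarith
  rw [hkey, abs_neg, abs_mul, abs_of_pos hεpos, abs_mul, abs_two]
  calc ε * (2 * |h₀ j|) ≤ ε * (2 * R) := by gcongr; exact hh₀j j
    _ = δ := by rw [← h2εR]; ring

end Gibbs

/-! ## Diagonal (torus) scalings of a tensor -/

section Torus

variable {K : Type*} {ι κ μ : Type*} [Fintype ι] [Fintype κ] [Fintype μ]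
variable [DecidableEq ι] [DecidableEq κ] [DecidableEq μ]

/-- `(diag d₁ ⊗ diag d₂ ⊗ diag d₃)·t` rescales entrywise: entry `d₁(a) d₂(b) d₃(c) t_{abc}`. [folklore] -/
theorem actTensor_diagonal_apply [CommSemiring K] (d₁ : ι → K) (d₂ : κ → K) (d₃ : μ → K)
    (t : ι → κ → μ → K) (a : ι) (b : κ) (c : μ) :
    actTensor (Matrix.diagonal d₁) (Matrix.diagonal d₂) (Matrix.diagonal d₃) t a b c =
      d₁ a * d₂ b * d₃ c * t a b c := by
  rw [actTensor_apply, Finset.sum_eq_single_of_mem a (Finset.mem_univ a)]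
  · rw [Finset.sum_eq_single_of_mem b (Finset.mem_univ b)]
    · rw [Finset.sum_eq_single_of_mem c (Finset.mem_univ c)]
      · simp only [Matrix.diagonal_apply_eq]
      · intro c' _ hc'
        simp [Matrix.diagonal_apply_ne _ (Ne.symm hc')]
    · intro b' _ hb'
      simp [Matrix.diagonal_apply_ne _ (Ne.symm hb')]
  · intro a' _ ha'
    simp [Matrix.diagonal_apply_ne _ (Ne.symm ha')]

/-- A torus scaling does not enlarge the support. [folklore] -/
theorem tensorSupport_actTensor_diagonal_subset [CommSemiring K] (d₁ : ι → K) (d₂ : κ → K)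
    (d₃ : μ → K) (t : ι → κ → μ → K) :
    tensorSupport (actTensor (Matrix.diagonal d₁) (Matrix.diagonal d₂) (Matrix.diagonal d₃) t) ⊆
      tensorSupport t := by
  rintro ⟨a, b, c⟩ h
  simp only [mem_tensorSupport, actTensor_diagonal_apply] at h ⊢
  intro h0
  exact h (by rw [h0, mul_zero])

end Torus

/-! ## Free supports: diagonal marginals, quantum entropy = entropy of `|s|²` -/

section FreeMarginals

variable {ι κ μ : Type*} [Fintype ι] [Fintype κ] [Fintype μ]

/-- `z · conj z = |z|²` as a real cast. [folklore] -/
theorem mul_star_self_eq_ofReal_norm_sq (z : ℂ) : z * star z = ((‖z‖ : ℝ) : ℂ) ^ 2 := by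
  rw [Complex.star_def, Complex.mul_conj, Complex.normSq_eq_norm_sq, Complex.ofReal_pow]

variable [DecidableEq ι] [DecidableEq κ] [DecidableEq μ]

omit [Fintype ι] [DecidableEq κ] [DecidableEq μ] in
/-- For a tensor with free support the first reduced density matrix is diagonal, with diagonal
the row sums of `|s|²` (CVZ, proof of Thm. 4.20: "freeness implies that the marginal density
matrices are diagonal"). [cite: ChristandlVranaZuiddam2023, Thm. 4.20 (proof)] -/
theorem reducedDensity₁_eq_diagonal_of_isFreeSet {s : ι → κ → μ → ℂ}
    (hs : IsFreeSet (tensorSupport s)) :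
    reducedDensity₁ s = Matrix.diagonal fun a => ((∑ b, ∑ c, ‖s a b c‖ ^ 2 : ℝ) : ℂ) := by
  ext a a'
  rw [reducedDensity₁_apply, Matrix.diagonal_apply]
  split_ifs with h
  · subst h
    push_cast
    exact Finset.sum_congr rfl fun b _ => Finset.sum_congr rfl fun c _ =>
      mul_star_self_eq_ofReal_norm_sq _
  · refine Finset.sum_eq_zero fun b _ => Finset.sum_eq_zero fun c _ => ?_
    by_contra hne
    rcases mul_ne_zero_iff.1 hne with ⟨h1, h2⟩
    rw [star_ne_zero] at h2
    have := hs.2.2 (show (a, b, c) ∈ tensorSupport s from h1)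
      (show (a', b, c) ∈ tensorSupport s from h2) rfl
    exact h (Prod.ext_iff.1 this).1

omit [Fintype κ] [DecidableEq ι] [DecidableEq μ] in
/-- For a tensor with free support the second reduced density matrix is diagonal.
[cite: ChristandlVranaZuiddam2023, Thm. 4.20 (proof)] -/
theorem reducedDensity₂_eq_diagonal_of_isFreeSet {s : ι → κ → μ → ℂ}
    (hs : IsFreeSet (tensorSupport s)) :
    reducedDensity₂ s = Matrix.diagonal fun b => ((∑ a, ∑ c, ‖s a b c‖ ^ 2 : ℝ) : ℂ) := by
  ext b b'
  rw [reducedDensity₂_apply, Matrix.diagonal_apply]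
  split_ifs with h
  · subst h
    push_cast
    exact Finset.sum_congr rfl fun a _ => Finset.sum_congr rfl fun c _ =>
      mul_star_self_eq_ofReal_norm_sq _
  · refine Finset.sum_eq_zero fun a _ => Finset.sum_eq_zero fun c _ => ?_
    by_contra hne
    rcases mul_ne_zero_iff.1 hne with ⟨h1, h2⟩
    rw [star_ne_zero] at h2
    have := hs.2.1 (show (a, b, c) ∈ tensorSupport s from h1)
      (show (a, b', c) ∈ tensorSupport s from h2) rfl
    exact h (Prod.ext_iff.1 (Prod.ext_iff.1 this).2).1

omit [Fintype μ] [DecidableEq ι] [DecidableEq κ] in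
/-- For a tensor with free support the third reduced density matrix is diagonal.
[cite: ChristandlVranaZuiddam2023, Thm. 4.20 (proof)] -/
theorem reducedDensity₃_eq_diagonal_of_isFreeSet {s : ι → κ → μ → ℂ}
    (hs : IsFreeSet (tensorSupport s)) :
    reducedDensity₃ s = Matrix.diagonal fun c => ((∑ a, ∑ b, ‖s a b c‖ ^ 2 : ℝ) : ℂ) := by
  ext c c'
  rw [reducedDensity₃_apply, Matrix.diagonal_apply]
  split_ifs with h
  · subst h
    push_cast
    exact Finset.sum_congr rfl fun a _ => Finset.sum_congr rfl fun b _ =>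
      mul_star_self_eq_ofReal_norm_sq _
  · refine Finset.sum_eq_zero fun a _ => Finset.sum_eq_zero fun b _ => ?_
    by_contra hne
    rcases mul_ne_zero_iff.1 hne with ⟨h1, h2⟩
    rw [star_ne_zero] at h2
    have := hs.1 (show (a, b, c) ∈ tensorSupport s from h1)
      (show (a, b, c') ∈ tensorSupport s from h2) rfl
    exact h (Prod.ext_iff.1 (Prod.ext_iff.1 this).2).2

/-- The eigenvalues of a real diagonal matrix are its diagonal entries, as a multiset. [folklore] -/
theorem univ_map_eigenvalues_of_eq_diagonal {n : Type*} [Fintype n] [DecidableEq n]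
    {A : Matrix n n ℂ} (hA : A.IsHermitian) (d : n → ℝ)
    (h : A = Matrix.diagonal fun i => ((d i : ℝ) : ℂ)) :
    Finset.univ.val.map hA.eigenvalues = Finset.univ.val.map d := by
  have h1 := hA.roots_charpoly_eq_eigenvalues
  have h2 : A.charpoly = ∏ i, (Polynomial.X - Polynomial.C ((d i : ℝ) : ℂ)) := by
    rw [h, Matrix.charpoly_diagonal]
  rw [h2, Polynomial.roots_prod _ _ (Finset.prod_ne_zero_iff.2 fun i _ => Polynomial.X_sub_C_ne_zero _)]
    at h1
  simp only [Polynomial.roots_X_sub_C, Multiset.bind_singleton] at h1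
  have h3 : Finset.univ.val.map (fun i => ((d i : ℝ) : ℂ)) =
      (Finset.univ.val.map d).map (RCLike.ofReal : ℝ → ℂ) := by
    rw [Multiset.map_map]; rfl
  rw [h3, ← Multiset.map_map] at h1
  exact (Multiset.map_injective (RCLike.ofReal_injective (K := ℂ)) h1).symm

/-- Sums of a function of the eigenvalues only depend on the eigenvalue multiset. [folklore] -/
theorem sum_comp_eq_of_univ_map_eq {α β M : Type*} [Fintype α] [AddCommMonoid M] {e d : α → β}
    (h : Finset.univ.val.map e = Finset.univ.val.map d) (f : β → M) :
    ∑ i, f (e i) = ∑ i, f (d i) := by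
  rw [Finset.sum_eq_multiset_sum, Finset.sum_eq_multiset_sum,
    show (fun i => f (e i)) = f ∘ e from rfl, show (fun i => f (d i)) = f ∘ d from rfl,
    ← Multiset.map_map, ← Multiset.map_map, h]

/-- **Freeness makes quantum and classical marginal entropies agree**: if `supp s` is free then
`H_θ(s)` (weighted von Neumann entropies of the one-particle marginals of `|s⟩⟨s|/⟨s|s⟩`) equals
`H_θ` of the probability distribution `|s_{abc}|² / ⟨s|s⟩` (CVZ, proof of Thm. 4.20:
"`μ_T(T·t) = μ_G(T·t)`"). [cite: ChristandlVranaZuiddam2023, Thm. 4.20 (proof)] -/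
theorem quantumEntropy_eq_weightedEntropy_of_isFreeSet (θ : Fin 3 → ℝ) {s : ι → κ → μ → ℂ}
    (hs : IsFreeSet (tensorSupport s)) :
    quantumEntropy θ s =
      weightedEntropy θ (fun x : ι × κ × μ => ‖s x.1 x.2.1 x.2.2‖ ^ 2 / tensorNormSq s) := by
  have e₁ := univ_map_eigenvalues_of_eq_diagonal (isHermitian_reducedDensity₁ s) _
    (reducedDensity₁_eq_diagonal_of_isFreeSet hs)
  have e₂ := univ_map_eigenvalues_of_eq_diagonal (isHermitian_reducedDensity₂ s) _
    (reducedDensity₂_eq_diagonal_of_isFreeSet hs)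
  have e₃ := univ_map_eigenvalues_of_eq_diagonal (isHermitian_reducedDensity₃ s) _
    (reducedDensity₃_eq_diagonal_of_isFreeSet hs)
  have h₁ : shannonEntropy (marginalSpectrum₁ s) =
      shannonEntropy (marginalDist₁ fun x : ι × κ × μ => ‖s x.1 x.2.1 x.2.2‖ ^ 2 / tensorNormSq s) := by
    simp only [shannonEntropy_def, marginalSpectrum₁, marginalDist₁]
    rw [sum_comp_eq_of_univ_map_eq e₁ (fun r => negMulLog (r / tensorNormSq s))]
    simp only [Finset.sum_div]
  have h₂ : shannonEntropy (marginalSpectrum₂ s) =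
      shannonEntropy (marginalDist₂ fun x : ι × κ × μ => ‖s x.1 x.2.1 x.2.2‖ ^ 2 / tensorNormSq s) := by
    simp only [shannonEntropy_def, marginalSpectrum₂, marginalDist₂]
    rw [sum_comp_eq_of_univ_map_eq e₂ (fun r => negMulLog (r / tensorNormSq s))]
    simp only [Finset.sum_div]
  have h₃ : shannonEntropy (marginalSpectrum₃ s) =
      shannonEntropy (marginalDist₃ fun x : ι × κ × μ => ‖s x.1 x.2.1 x.2.2‖ ^ 2 / tensorNormSq s) := by
    simp only [shannonEntropy_def, marginalSpectrum₃, marginalDist₃]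
    rw [sum_comp_eq_of_univ_map_eq e₃ (fun r => negMulLog (r / tensorNormSq s))]
    simp only [Finset.sum_div]
  rw [quantumEntropy, weightedEntropy, h₁, h₂, h₃]

end FreeMarginals

/-! ## CVZ Thm. 4.20, the half `ρ^θ(t) ≤ E_θ(t)` for free `t` -/

section FreeLower

variable {ι κ μ : Type*} [Fintype ι] [Fintype κ] [Fintype μ]

/-- Indicator sums over a triple product pick out the marginals (first coordinate). [folklore] -/
theorem sum_mul_ite_fst_eq [DecidableEq ι] (F : ι × κ × μ → ℝ) (a : ι) :
    ∑ x, F x * (if x.1 = a then 1 else 0) = ∑ b, ∑ c, F (a, b, c) := by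
  rw [Fintype.sum_prod_type, Finset.sum_eq_single a]
  · simp [Fintype.sum_prod_type]
  · intro a' _ ha'
    simp [ha']
  · simp

/-- Indicator sums over a triple product pick out the marginals (second coordinate). [folklore] -/
theorem sum_mul_ite_snd_eq [DecidableEq κ] (F : ι × κ × μ → ℝ) (b : κ) :
    ∑ x, F x * (if x.2.1 = b then 1 else 0) = ∑ a, ∑ c, F (a, b, c) := by
  rw [Fintype.sum_prod_type]
  refine Finset.sum_congr rfl fun a _ => ?_
  rw [Fintype.sum_prod_type, Finset.sum_eq_single b]
  · simp
  · intro b' _ hb'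
    simp [hb']
  · simp

/-- Indicator sums over a triple product pick out the marginals (third coordinate). [folklore] -/
theorem sum_mul_ite_thd_eq [DecidableEq μ] (F : ι × κ × μ → ℝ) (c : μ) :
    ∑ x, F x * (if x.2.2 = c then 1 else 0) = ∑ a, ∑ b, F (a, b, c) := by
  rw [Fintype.sum_prod_type]
  refine Finset.sum_congr rfl fun a _ => ?_
  rw [Fintype.sum_prod_type]
  refine Finset.sum_congr rfl fun b _ => ?_
  rw [Finset.sum_eq_single c]
  · simp
  · intro c' _ hc'
    simp [hc']
  · simp

variable [DecidableEq ι] [DecidableEq κ] [DecidableEq μ]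

/-- **Key estimate for CVZ Thm. 4.20**: if the support of `t₀ = (G₁ ⊗ G₂ ⊗ G₃)·t` (`Gᵢ` invertible) is
free, then every probability distribution `P` supported in `supp t₀` has `H_θ(P) ≤ E_θ(t)`: the
torus orbit of `t₀` contains tensors `s` with `|s|²/‖s‖²` having marginals arbitrarily close to those
of `P` (`exists_gibbs_moments_approx`), and `H_θ(s)` equals the classical `H_θ` of `|s|²/‖s‖²` by
freeness. [cite: ChristandlVranaZuiddam2023, Thm. 4.20 (proof)] -/
theorem weightedEntropy_le_logQuantumFunctional_of_isFreeSet {θ : Fin 3 → ℝ} (hθ : ∀ i, 0 ≤ θ i)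
    (t : ι → κ → μ → ℂ) (g₀ : GL ι ℂ × GL κ ℂ × GL μ ℂ)
    (hfree : IsFreeSet (tensorSupport
      (actTensor (g₀.1 : Matrix ι ι ℂ) (g₀.2.1 : Matrix κ κ ℂ) (g₀.2.2 : Matrix μ μ ℂ) t)))
    {P : ι × κ × μ → ℝ} (hP : P ∈ stdSimplex ℝ (ι × κ × μ))
    (hPs : Function.support P ⊆ tensorSupport
      (actTensor (g₀.1 : Matrix ι ι ℂ) (g₀.2.1 : Matrix κ κ ℂ) (g₀.2.2 : Matrix μ μ ℂ) t)) :
    weightedEntropy θ P ≤ logQuantumFunctional θ t := by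
  -- notation
  set t₀ : ι → κ → μ → ℂ :=
    actTensor (g₀.1 : Matrix ι ι ℂ) (g₀.2.1 : Matrix κ κ ℂ) (g₀.2.2 : Matrix μ μ ℂ) t with ht₀
  let q : ι × κ × μ → ℝ := fun x => ‖t₀ x.1 x.2.1 x.2.2‖ ^ 2
  let w : ι × κ × μ → (ι ⊕ κ ⊕ μ) → ℝ := fun x =>
    Sum.elim (fun a => if x.1 = a then 1 else 0)
      (Sum.elim (fun b => if x.2.1 = b then 1 else 0) (fun c => if x.2.2 = c then 1 else 0))
  -- the entropy as a continuous function of the marginal vector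
  let Ψ : ((ι ⊕ κ ⊕ μ) → ℝ) → ℝ := fun v =>
    θ 0 * shannonEntropy (fun a => v (Sum.inl a)) +
      θ 1 * shannonEntropy (fun b => v (Sum.inr (Sum.inl b))) +
      θ 2 * shannonEntropy (fun c => v (Sum.inr (Sum.inr c)))
  let mv : (ι × κ × μ → ℝ) → (ι ⊕ κ ⊕ μ) → ℝ := fun Q =>
    Sum.elim (marginalDist₁ Q) (Sum.elim (marginalDist₂ Q) (marginalDist₃ Q))
  have hΨmv : ∀ Q, Ψ (mv Q) = weightedEntropy θ Q := fun Q => rfl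
  have hΨc : Continuous Ψ := by
    have hS₁ : Continuous fun v : (ι ⊕ κ ⊕ μ) → ℝ => shannonEntropy fun a : ι => v (Sum.inl a) := by
      unfold shannonEntropy
      exact (continuous_finsetSum _ fun a _ =>
        Real.continuous_negMulLog.comp (continuous_apply _)).div_const _
    have hS₂ : Continuous fun v : (ι ⊕ κ ⊕ μ) → ℝ =>
        shannonEntropy fun b : κ => v (Sum.inr (Sum.inl b)) := by
      unfold shannonEntropy
      exact (continuous_finsetSum _ fun a _ =>
        Real.continuous_negMulLog.comp (continuous_apply _)).div_const _
    have hS₃ : Continuous fun v : (ι ⊕ κ ⊕ μ) → ℝ =>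
        shannonEntropy fun c : μ => v (Sum.inr (Sum.inr c)) := by
      unfold shannonEntropy
      exact (continuous_finsetSum _ fun a _ =>
        Real.continuous_negMulLog.comp (continuous_apply _)).div_const _
    exact ((continuous_const.mul hS₁).add (continuous_const.mul hS₂)).add
      (continuous_const.mul hS₃)
  have hmvw : ∀ (Q : ι × κ × μ → ℝ) (j), mv Q j = ∑ x, Q x * w x j := by
    intro Q j
    rcases j with a | b | c
    · exact (sum_mul_ite_fst_eq Q a).symm
    · exact (sum_mul_ite_snd_eq Q b).symm
    · exact (sum_mul_ite_thd_eq Q c).symm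
  have hwsum : ∀ (h : (ι ⊕ κ ⊕ μ) → ℝ) (x : ι × κ × μ),
      ∑ i, h i * w x i = h (Sum.inl x.1) + h (Sum.inr (Sum.inl x.2.1)) + h (Sum.inr (Sum.inr x.2.2)) := by
    intro h x
    simp only [w, Fintype.sum_sum_type, Sum.elim_inl, Sum.elim_inr, mul_ite, mul_one, mul_zero,
      Finset.sum_ite_eq, Finset.mem_univ, if_true, add_assoc]
  -- `ε/δ` bookkeeping
  refine le_of_forall_pos_lt_add fun η hη => ?_
  obtain ⟨δ, hδ, hδΨ⟩ := Metric.continuousAt_iff.1 (hΨc.continuousAt (x := mv P)) η hη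
  have hq0 : ∀ x, 0 ≤ q x := fun x => sq_nonneg _
  have hPq : ∀ x, P x ≠ 0 → q x ≠ 0 := by
    intro x hx
    have hx' : x ∈ tensorSupport t₀ := hPs (Function.mem_support.2 hx)
    exact pow_ne_zero 2 (norm_ne_zero_iff.2 hx')
  obtain ⟨h, hh⟩ := exists_gibbs_moments_approx q P hq0 hP.1 hP.2 hPq w (half_pos hδ)
  -- the torus element `diag(e^{h/2})` and the scaled tensor `s`
  let d₁ : ι → ℂ := fun a => ((Real.exp (h (Sum.inl a) / 2) : ℝ) : ℂ)
  let d₂ : κ → ℂ := fun b => ((Real.exp (h (Sum.inr (Sum.inl b)) / 2) : ℝ) : ℂ)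
  let d₃ : μ → ℂ := fun c => ((Real.exp (h (Sum.inr (Sum.inr c)) / 2) : ℝ) : ℂ)
  set s : ι → κ → μ → ℂ :=
    actTensor (Matrix.diagonal d₁) (Matrix.diagonal d₂) (Matrix.diagonal d₃) t₀ with hs_def
  have hs_normsq : ∀ x : ι × κ × μ,
      ‖s x.1 x.2.1 x.2.2‖ ^ 2 = q x * Real.exp (∑ i, h i * w x i) := by
    rintro ⟨a, b, c⟩
    have hexp : ∀ z : ℝ, ‖((Real.exp (z / 2) : ℝ) : ℂ)‖ ^ 2 = Real.exp z := fun z => by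
      rw [Complex.norm_of_nonneg (Real.exp_pos _).le, sq, ← Real.exp_add, add_halves]
    simp only [hs_def, actTensor_diagonal_apply, norm_mul, mul_pow, d₁, d₂, d₃, hexp, hwsum, q,
      Real.exp_add]
    ring
  -- `s` lies in the `GL³`-orbit of `t`
  have hd₁ : (Matrix.diagonal d₁).det ≠ 0 := by
    rw [Matrix.det_diagonal]
    exact Finset.prod_ne_zero_iff.2 fun a _ => Complex.ofReal_ne_zero.2 (Real.exp_pos _).ne'
  have hd₂ : (Matrix.diagonal d₂).det ≠ 0 := by
    rw [Matrix.det_diagonal]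
    exact Finset.prod_ne_zero_iff.2 fun a _ => Complex.ofReal_ne_zero.2 (Real.exp_pos _).ne'
  have hd₃ : (Matrix.diagonal d₃).det ≠ 0 := by
    rw [Matrix.det_diagonal]
    exact Finset.prod_ne_zero_iff.2 fun a _ => Complex.ofReal_ne_zero.2 (Real.exp_pos _).ne'
  let g : GL ι ℂ × GL κ ℂ × GL μ ℂ :=
    (Matrix.GeneralLinearGroup.mkOfDetNeZero _ hd₁ * g₀.1,
      Matrix.GeneralLinearGroup.mkOfDetNeZero _ hd₂ * g₀.2.1,
      Matrix.GeneralLinearGroup.mkOfDetNeZero _ hd₃ * g₀.2.2)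
  have hgs : actTensor (g.1 : Matrix ι ι ℂ) (g.2.1 : Matrix κ κ ℂ) (g.2.2 : Matrix μ μ ℂ) t = s := by
    simp only [g, Units.val_mul, Matrix.GeneralLinearGroup.val_mkOfDetNeZero, hs_def, ht₀]
    exact (actTensor_actTensor _ _ _ _ _ _ t).symm
  have hsE : quantumEntropy θ s ≤ logQuantumFunctional θ t := by
    rw [← hgs]
    exact quantumEntropy_actTensor_le_logQuantumFunctional hθ t g
  -- freeness of `supp s ⊆ supp t₀` turns `H_θ(s)` into a classical weighted entropy
  have hsfree : IsFreeSet (tensorSupport s) :=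
    hfree.mono (tensorSupport_actTensor_diagonal_subset d₁ d₂ d₃ t₀)
  set Q : ι × κ × μ → ℝ := fun x => ‖s x.1 x.2.1 x.2.2‖ ^ 2 / tensorNormSq s with hQ
  have hsQ : quantumEntropy θ s = weightedEntropy θ Q :=
    quantumEntropy_eq_weightedEntropy_of_isFreeSet θ hsfree
  -- the marginals of `Q` are the Gibbs moments
  have hN : tensorNormSq s = ∑ x, q x * Real.exp (∑ i, h i * w x i) := by
    simp only [tensorNormSq, ← hs_normsq, Fintype.sum_prod_type]
  have hmvQ : ∀ j, mv Q j = (∑ x, q x * Real.exp (∑ i, h i * w x i) * w x j) /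
      ∑ x, q x * Real.exp (∑ i, h i * w x i) := by
    intro j
    rw [hmvw, ← hN, Finset.sum_div]
    refine Finset.sum_congr rfl fun x _ => ?_
    simp only [hQ, hs_normsq]
    ring
  have hdist : dist (mv Q) (mv P) < δ := by
    refine (dist_pi_le_iff (half_pos hδ).le).2 (fun j => ?_) |>.trans_lt (half_lt_self hδ)
    rw [Real.dist_eq, hmvQ, hmvw]
    exact hh j
  have hclose := hδΨ hdist
  rw [Real.dist_eq, hΨmv, hΨmv] at hclose
  calc weightedEntropy θ P < weightedEntropy θ Q + η := by
        have := (abs_sub_lt_iff.1 hclose).2; linarith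
    _ = quantumEntropy θ s + η := by rw [hsQ]
    _ ≤ logQuantumFunctional θ t + η := by gcongr

/-- For free `supp ((G₁ ⊗ G₂ ⊗ G₃)·t)`: `H_θ(supp ((G₁ ⊗ G₂ ⊗ G₃)·t)) ≤ E_θ(t)`.
[cite: ChristandlVranaZuiddam2023, Thm. 4.20 (proof)] -/
theorem maxWeightedEntropy_le_logQuantumFunctional_of_isFreeSet {θ : Fin 3 → ℝ} (hθ : ∀ i, 0 ≤ θ i)
    (t : ι → κ → μ → ℂ) (g₀ : GL ι ℂ × GL κ ℂ × GL μ ℂ)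
    (hfree : IsFreeSet (tensorSupport
      (actTensor (g₀.1 : Matrix ι ι ℂ) (g₀.2.1 : Matrix κ κ ℂ) (g₀.2.2 : Matrix μ μ ℂ) t))) :
    maxWeightedEntropy θ (tensorSupport
      (actTensor (g₀.1 : Matrix ι ι ℂ) (g₀.2.1 : Matrix κ κ ℂ) (g₀.2.2 : Matrix μ μ ℂ) t)) ≤
      logQuantumFunctional θ t := by
  unfold maxWeightedEntropy
  rcases Set.eq_empty_or_nonempty (weightedEntropy θ ''
      {P : ι × κ × μ → ℝ | P ∈ stdSimplex ℝ (ι × κ × μ) ∧ Function.support P ⊆ tensorSupport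
        (actTensor (g₀.1 : Matrix ι ι ℂ) (g₀.2.1 : Matrix κ κ ℂ) (g₀.2.2 : Matrix μ μ ℂ) t)})
    with h | h
  · rw [h, Real.sSup_empty]
    exact logQuantumFunctional_nonneg hθ t
  · refine csSup_le h ?_
    rintro _ ⟨P, ⟨hP, hs⟩, rfl⟩
    exact weightedEntropy_le_logQuantumFunctional_of_isFreeSet hθ t g₀ hfree hP hs

/-- **CVZ Thm. 4.20, the half `ρ^θ(t) ≤ E_θ(t)` for free tensors** (proved): for `θ ≥ 0` and `t`
free, the logarithmic upper support functional is at most the logarithmic quantum functional.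
[cite: ChristandlVranaZuiddam2023, Thm. 4.20] -/
theorem logUpperSupportFunctional_le_logQuantumFunctional_of_isFree {θ : Fin 3 → ℝ}
    (hθ : ∀ i, 0 ≤ θ i) {t : ι → κ → μ → ℂ} (ht : IsFree t) :
    logUpperSupportFunctional θ t ≤ logQuantumFunctional θ t := by
  obtain ⟨g₀, hfree⟩ := ht
  refine (ciInf_le ⟨0, ?_⟩ g₀).trans
    (maxWeightedEntropy_le_logQuantumFunctional_of_isFreeSet hθ t g₀ hfree)
  rintro _ ⟨g, rfl⟩
  exact maxWeightedEntropy_nonneg hθ _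

/-- Exponentiated form of the proved half of CVZ Thm. 4.20: `ζ^θ(t) ≤ F^θ(t)` for `t` free and
`θ ≥ 0`. [cite: ChristandlVranaZuiddam2023, Thm. 4.20] -/
theorem upperSupportFunctional_le_quantumFunctional_of_isFree {θ : Fin 3 → ℝ}
    (hθ : ∀ i, 0 ≤ θ i) {t : ι → κ → μ → ℂ} (ht : IsFree t) :
    upperSupportFunctional θ t ≤ quantumFunctional θ t := by
  by_cases ht0 : t = 0
  · subst ht0
    simp
  · rw [upperSupportFunctional, if_neg ht0, quantumFunctional_of_ne_zero θ ht0]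
    exact Real.rpow_le_rpow_of_exponent_le one_le_two
      (logUpperSupportFunctional_le_logQuantumFunctional_of_isFree hθ ht)

end FreeLower

/-! ## Assembly: Thm. 4.20 from Thm. 3.34 + 3.30 -/

section Assembly

universe u

/-- **CVZ Thm. 4.20 reduced to Thm. 3.34/3.30**: the named fact `ChristandlVranaZuiddam2023_free`
(`ρ^θ(t) = E_θ(t)` and `ζ^θ(t) = F^θ(t)` for free `t`, `θ ∈ P([3])`) follows from the named fact
`ChristandlVranaZuiddam2023_le_upperSupportFunctional` (`E_θ ≤ ρ^θ`, Thm. 3.34 with Thm. 3.30); the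
reverse inequality for free tensors is `logUpperSupportFunctional_le_logQuantumFunctional_of_isFree`.
This is exactly the structure of the printed proof ("By Thm. 3.34 and Thm. 3.30 we have
`ρ^θ(t) ≥ E^θ(t) = E_θ(t)`. We prove `ρ^θ(t) ≤ E_θ(t)`."). [cite: ChristandlVranaZuiddam2023, Thm. 4.20] -/
theorem ChristandlVranaZuiddam2023_free_of_le_upperSupportFunctional
    (h : ChristandlVranaZuiddam2023_le_upperSupportFunctional.{u}) :
    ChristandlVranaZuiddam2023_free.{u} := by
  intro θ hθ ι κ μ _ _ _ _ _ _ t ht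
  have hθ' : ∀ i, 0 ≤ θ i := fun i => hθ.1 i
  have h1 : logUpperSupportFunctional θ t = logQuantumFunctional θ t :=
    le_antisymm (logUpperSupportFunctional_le_logQuantumFunctional_of_isFree hθ' ht) (h θ hθ t).1
  refine ⟨h1, ?_⟩
  by_cases ht0 : t = 0
  · subst ht0
    simp
  · rw [upperSupportFunctional, if_neg ht0, quantumFunctional_of_ne_zero θ ht0, h1]

end Assembly

end Literature.Computability.AlgebraicComplexity

end
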